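import Literature.NumberTheory.DiophantineApproximation.LeVequeInequality
import Mathlib.MeasureTheory.Integral.IntervalIntegral.FundThmCalculus
import Mathlib.MeasureTheory.Integral.IntervalIntegral.IntegrationByParts
import Mathlib.Tactic
import HarnessLib

/-!
# Koksma's inequality

**Koksma's inequality** (J. F. Koksma 1942/43; Kuipers–Niederreiter, *Uniform distribution of
sequences*, Ch. 2 Theorem 5.1; Drmota–Tichy Theorem 1.14): for points `y₁,…,y_N ∈ [0,1)` with
discrepancy `D_N` and a function `g` of bounded variation `V(g)` on `[0,1]`,
`|(1/N) Σ_n g(y_n) − ∫₀¹ g| ≤ V(g) · D_N`.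
It is the numerical-integration step of Calegari–Dimitrov–Tang's fine holonomy bound
[CalegariDimitrovTang2024, §6.5.4 "The numerical integration" (p. 54): "Koksma's inequality (see,
for instance, [UDC] for a discussion and further references)"], stated in
[CalegariDimitrovTang2025, §2.5.1 eq. (Koksma) (p. 12)] in the `C¹` form
`|(1/d) Σ_j g(z_j) − ∫_𝕋 g| ≤ V(g) D(z)`, `V(g) = ∫_𝕋 |g'|` for `g ∈ C¹(𝕋)`.

We prove the `C¹` form on `[0,1]` (`koksma`): for `g` differentiable at every point of `[0,1]`
with continuous derivative `g'` and `y ∈ [0,1)^N`,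
`|(1/N) Σ_n g(y_n) − ∫₀¹ g| ≤ D_N(y) · ∫₀¹ |g'|`,
with `D_N = boxDiscrepancy y` the box discrepancy of [CalegariDimitrovTang2024, Def. 44] from the
LeVeque file (the periodic/circle form of [CalegariDimitrovTang2025] is the special case of a
`1`-periodic `g`, the arc discrepancy of `e(y) ∈ 𝕋^N` dominating the interval one). The proof is
the classical Abel-summation identity in its continuous form
`∫₀¹ Δ(t) g'(t) dt = ∫₀¹ g − (1/N) Σ_n g(y_n)` for the local discrepancy
`Δ(t) = #{n : y_n < t}/N − t` (`integral_delta_mul_deriv`), together with the star-discrepancy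
bound `|Δ(t)| ≤ D_N` (`abs_delta_le_boxDiscrepancy`).

## References
* [CalegariDimitrovTang2024] F. Calegari, V. Dimitrov, Y. Tang, arXiv:2408.15403, §6.5.4 (p. 54).
* [CalegariDimitrovTang2025] F. Calegari, V. Dimitrov, Y. Tang, *The unbounded denominators
  conjecture*, J. Amer. Math. Soc. 38 (2025), §2.5.1 eq. (Koksma) (arXiv:2109.09040 p. 12).
* [KuipersNiederreiter1974] L. Kuipers, H. Niederreiter, *Uniform distribution of sequences*,
  Wiley 1974, Ch. 2 §5 Theorem 5.1 (Koksma's inequality).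
-/

namespace Literature.NumberTheory.DiophantineApproximation

namespace Discrepancy

open MeasureTheory Set intervalIntegral

noncomputable section

variable {N : ℕ}

/-- The local discrepancies are bounded above (by `2`). [folklore] -/
theorem bddAbove_localDisc (y : Fin N → ℝ) :
    BddAbove ((fun ab : ℝ × ℝ => localDisc y ab.1 ab.2) '' {ab | 0 ≤ ab.1 ∧ ab.1 ≤ ab.2 ∧ ab.2 ≤ 1}) := by
  refine ⟨2, ?_⟩
  rintro _ ⟨⟨a, b⟩, ⟨ha, hab, hb⟩, rfl⟩
  simp only
  unfold localDisc
  have h1 : |b - a| ≤ 1 := by rw [abs_le]; constructor <;> linarith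
  have h2 : |((Finset.univ.filter fun n => a ≤ y n ∧ y n ≤ b).card : ℝ) / N| ≤ 1 := by
    rw [abs_of_nonneg (by positivity)]
    rcases Nat.eq_zero_or_pos N with hN | hN
    · subst hN; simp
    · rw [div_le_one (by exact_mod_cast hN)]
      exact_mod_cast (Finset.card_le_univ _).trans (by simp)
  calc _ ≤ |b - a| + |((Finset.univ.filter fun n => a ≤ y n ∧ y n ≤ b).card : ℝ) / N| :=
        abs_sub _ _
    _ ≤ 2 := by linarith

/-- Each local discrepancy is at most the box discrepancy. [cite: CalegariDimitrovTang2024,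
§4.1 Definition 44] -/
theorem localDisc_le_boxDiscrepancy (y : Fin N → ℝ) {a b : ℝ} (ha : 0 ≤ a) (hab : a ≤ b) (hb : b ≤ 1) :
    localDisc y a b ≤ boxDiscrepancy y :=
  le_csSup (bddAbove_localDisc y) ⟨(a, b), ⟨ha, hab, hb⟩, rfl⟩

/-- **Star discrepancy ≤ box discrepancy**: `|#{n : y_n < t}/N − t| ≤ D_N(y)` for `t ∈ [0,1]`
and points `y_n ≥ 0` (approximate `[0,t)` by closed intervals `[0,b]`, `b ↑ t`). [folklore] -/
theorem abs_delta_le_boxDiscrepancy {y : Fin N → ℝ} (hy0 : ∀ n, 0 ≤ y n) {t : ℝ}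
    (ht : t ∈ Icc (0 : ℝ) 1) : |delta y t| ≤ boxDiscrepancy y := by
  rcases eq_or_lt_of_le ht.1 with rfl | htpos
  · rw [delta_zero hy0, abs_zero]; exact boxDiscrepancy_nonneg y
  refine le_of_forall_pos_lt_add fun ε hε => ?_
  -- the largest point below `t` (or `0`)
  classical
  set S : Finset ℝ := (Finset.univ.filter fun n => y n < t).image y with hS
  have hSlt : ∀ x ∈ S, x < t := by
    intro x hx
    obtain ⟨n, hn, rfl⟩ := Finset.mem_image.mp hx
    exact (Finset.mem_filter.mp hn).2
  set m : ℝ := if h : S.Nonempty then S.max' h else 0 with hm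
  have hm0 : 0 ≤ m := by
    rw [hm]; split_ifs with h
    · obtain ⟨x, hx⟩ := h
      obtain ⟨n, _, rfl⟩ := Finset.mem_image.mp hx
      exact (hy0 n).trans (S.le_max' _ hx)
    · exact le_rfl
  have hmt : m < t := by
    rw [hm]; split_ifs with h
    · exact hSlt _ (S.max'_mem h)
    · exact htpos
  have hSm : ∀ x ∈ S, x ≤ m := by
    intro x hx
    rw [hm, dif_pos ⟨x, hx⟩]
    exact S.le_max' x hx
  -- the approximating closed interval `[0, b]`
  set ε' : ℝ := min ε t / 2 with hε'
  have hε'0 : 0 < ε' := by rw [hε']; positivity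
  have hε'ε : ε' < ε := by
    rw [hε']; have := min_le_left ε t; linarith
  have hε't : ε' < t := by
    rw [hε']; have := min_le_right ε t; linarith
  set b : ℝ := max m (t - ε') with hb
  have hb0 : 0 ≤ b := hm0.trans (le_max_left _ _)
  have hbt : b < t := max_lt hmt (by linarith)
  have hb1 : b ≤ 1 := hbt.le.trans ht.2
  have htb : t - b ≤ ε' := by have := le_max_right m (t - ε'); linarith
  -- the counts agree
  have hcount : ((Finset.univ.filter fun n => 0 ≤ y n ∧ y n ≤ b).card : ℝ) = countLT y t := by
    unfold countLT
    congr 2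
    ext n
    simp only [Finset.mem_filter, Finset.mem_univ, true_and]
    constructor
    · rintro ⟨-, h⟩; exact lt_of_le_of_lt h hbt
    · intro h
      refine ⟨hy0 n, ?_⟩
      have : y n ∈ S := Finset.mem_image.mpr ⟨n, Finset.mem_filter.mpr ⟨Finset.mem_univ n, h⟩, rfl⟩
      exact (hSm _ this).trans (le_max_left _ _)
  have hloc : localDisc y 0 b = |b - (countLT y t : ℝ) / N| := by
    unfold localDisc; rw [sub_zero, hcount]
  have hD : |b - (countLT y t : ℝ) / N| ≤ boxDiscrepancy y := by
    rw [← hloc]; exact localDisc_le_boxDiscrepancy y le_rfl hb0 hb1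
  have hdelta : delta y t = -(t - (countLT y t : ℝ) / N) := by unfold delta; ring
  rw [hdelta, abs_neg]
  calc |t - (countLT y t : ℝ) / N| = |(b - (countLT y t : ℝ) / N) + (t - b)| := by ring_nf
    _ ≤ |b - (countLT y t : ℝ) / N| + |t - b| := abs_add_le _ _
    _ ≤ boxDiscrepancy y + ε' := by rw [abs_of_nonneg (sub_nonneg.mpr hbt.le)]; linarith
    _ < boxDiscrepancy y + ε := by linarith

/-- Integrability of `t ↦ 1[x < t] g'(t)` on subintervals of `[0,1]`. [folklore] -/
theorem intervalIntegrable_ind_mul {g' : ℝ → ℝ} (hg' : ContinuousOn g' (Icc (0 : ℝ) 1)) (x : ℝ)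
    {a b : ℝ} (ha : 0 ≤ a) (hab : a ≤ b) (hb : b ≤ 1) :
    IntervalIntegrable (fun t => (if x < t then (1 : ℝ) else 0) * g' t) volume a b := by
  have hind : (fun t => (if x < t then (1 : ℝ) else 0)) = (Ioi x).indicator (fun _ => (1 : ℝ)) := by
    funext t; simp [Set.indicator_apply]
  have h1 : IntervalIntegrable (fun t => (if x < t then (1 : ℝ) else 0)) volume a b := by
    rw [hind, intervalIntegrable_iff]
    exact (intervalIntegrable_iff.mp intervalIntegrable_const).indicator measurableSet_Ioi
  exact h1.mul_continuousOn (hg'.mono (by rw [uIcc_of_le hab]; exact Icc_subset_Icc ha hb))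

/-- The indicator integral `∫₀¹ 1[x < t] g'(t) dt = g(1) − g(x)` for `x ∈ [0,1)`.
[folklore] -/
theorem integral_indicator_mul_deriv {g g' : ℝ → ℝ} (hg : ∀ t ∈ Icc (0 : ℝ) 1, HasDerivAt g (g' t) t)
    (hg' : ContinuousOn g' (Icc (0 : ℝ) 1)) {x : ℝ} (hx0 : 0 ≤ x) (hx1 : x < 1) :
    ∫ t in (0 : ℝ)..1, (if x < t then (1 : ℝ) else 0) * g' t = g 1 - g x := by
  rw [← integral_add_adjacent_intervals (b := x)
    (intervalIntegrable_ind_mul hg' x le_rfl hx0 hx1.le) (intervalIntegrable_ind_mul hg' x hx0 hx1.le le_rfl)]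
  have h1 : ∫ t in (0 : ℝ)..x, (if x < t then (1 : ℝ) else 0) * g' t = 0 := by
    rw [integral_of_le hx0]
    refine setIntegral_eq_zero_of_forall_eq_zero fun t ht => ?_
    rw [if_neg (not_lt.mpr ht.2), zero_mul]
  have h2 : ∫ t in x..1, (if x < t then (1 : ℝ) else 0) * g' t = ∫ t in x..1, g' t := by
    rw [integral_of_le hx1.le, integral_of_le hx1.le]
    refine setIntegral_congr_fun measurableSet_Ioc fun t ht => ?_
    rw [if_pos ht.1, one_mul]
  rw [h1, h2, zero_add]
  refine integral_eq_sub_of_hasDerivAt (fun t ht => hg t ?_) ?_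
  · rw [uIcc_of_le hx1.le] at ht; exact ⟨hx0.trans ht.1, ht.2⟩
  · exact (hg'.mono (by rw [uIcc_of_le hx1.le]; exact Icc_subset_Icc hx0 le_rfl)).intervalIntegrable

/-- **The Abel-summation identity**: `∫₀¹ Δ(t) g'(t) dt = ∫₀¹ g − (1/N) Σ_n g(y_n)` for
`Δ(t) = #{n : y_n < t}/N − t`, `y ∈ [0,1)^N`, `g ∈ C¹[0,1]`.
[cite: KuipersNiederreiter1974, Ch. 2 §5, proof of Theorem 5.1] -/
theorem integral_delta_mul_deriv (hN : 0 < N) {y : Fin N → ℝ} (hy0 : ∀ n, 0 ≤ y n) (hy1 : ∀ n, y n < 1)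
    {g g' : ℝ → ℝ} (hg : ∀ t ∈ Icc (0 : ℝ) 1, HasDerivAt g (g' t) t) (hg' : ContinuousOn g' (Icc (0 : ℝ) 1)) :
    ∫ t in (0 : ℝ)..1, delta y t * g' t = (∫ t in (0 : ℝ)..1, g t) - (∑ n, g (y n)) / N := by
  have hNr : (N : ℝ) ≠ 0 := by exact_mod_cast hN.ne'
  have hg'int : IntervalIntegrable g' volume 0 1 :=
    (hg'.mono (by rw [uIcc_of_le zero_le_one])).intervalIntegrable
  -- expand `Δ(t) g'(t) = (1/N) Σ_n 1[y_n < t] g'(t) − t g'(t)`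
  have hΔ : EqOn (fun t => delta y t * g' t)
      (fun t => (1 / (N : ℝ)) * ∑ n, (if y n < t then (1 : ℝ) else 0) * g' t - t * g' t) (uIcc 0 1) := by
    intro t _
    simp only
    rw [delta, countLT_eq_sum, sub_mul, div_mul_eq_mul_div, Finset.sum_mul]
    ring
  rw [integral_congr hΔ]
  have hint1 : ∀ n, IntervalIntegrable (fun t => (if y n < t then (1 : ℝ) else 0) * g' t) volume 0 1 :=
    fun n => intervalIntegrable_ind_mul hg' (y n) le_rfl zero_le_one le_rfl
  have hintS : IntervalIntegrable (fun t => ∑ n, (if y n < t then (1 : ℝ) else 0) * g' t) volume 0 1 := by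
    have := IntervalIntegrable.sum (Finset.univ) (fun n _ => hint1 n)
    exact this.congr fun t _ => Finset.sum_apply t _ _
  have hintT : IntervalIntegrable (fun t => t * g' t) volume 0 1 :=
    intervalIntegral.intervalIntegrable_id.mul_continuousOn (hg'.mono (by rw [uIcc_of_le zero_le_one]))
  rw [integral_sub (hintS.const_mul _) hintT, intervalIntegral.integral_const_mul,
    intervalIntegral.integral_finsetSum fun n _ => hint1 n]
  simp_rw [integral_indicator_mul_deriv hg hg' (hy0 _) (hy1 _)]
  -- integration by parts for `∫ t g'(t)`
  have hparts : ∫ t in (0 : ℝ)..1, t * g' t = g 1 - ∫ t in (0 : ℝ)..1, g t := by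
    have h := integral_mul_deriv_eq_deriv_mul (u := fun t => t) (u' := fun _ => (1 : ℝ)) (v := g) (v' := g')
      (a := 0) (b := 1) (fun t _ => hasDerivAt_id t) (fun t ht => hg t (by rwa [uIcc_of_le zero_le_one] at ht))
      intervalIntegrable_const hg'int
    rw [h]
    simp
  rw [hparts, Finset.sum_sub_distrib, Finset.sum_const, Finset.card_univ, Fintype.card_fin, nsmul_eq_mul]
  field_simp
  ring

/-- **Koksma's inequality** (`C¹` form, [CalegariDimitrovTang2025, eq. (Koksma)];
[KuipersNiederreiter1974, Ch. 2 Theorem 5.1]): for points `y₁,…,y_N ∈ [0,1)` with box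
discrepancy `D_N(y)` and `g` differentiable on `[0,1]` with continuous derivative `g'`,
`|(1/N) Σ_n g(y_n) − ∫₀¹ g| ≤ D_N(y) · ∫₀¹ |g'|` (the right factor is the total variation
`V(g)`). [cite: CalegariDimitrovTang2024, §6.5.4 (p. 54); KuipersNiederreiter1974, Ch. 2 Thm 5.1] -/
theorem koksma (hN : 0 < N) {y : Fin N → ℝ} (hy0 : ∀ n, 0 ≤ y n) (hy1 : ∀ n, y n < 1)
    {g g' : ℝ → ℝ} (hg : ∀ t ∈ Icc (0 : ℝ) 1, HasDerivAt g (g' t) t) (hg' : ContinuousOn g' (Icc (0 : ℝ) 1)) :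
    |(∑ n, g (y n)) / N - ∫ t in (0 : ℝ)..1, g t| ≤
      boxDiscrepancy y * ∫ t in (0 : ℝ)..1, |g' t| := by
  have hid := integral_delta_mul_deriv hN hy0 hy1 hg hg'
  have hg'c : ContinuousOn g' (uIcc (0 : ℝ) 1) := hg'.mono (by rw [uIcc_of_le zero_le_one])
  have hΔint : IntervalIntegrable (fun t => delta y t * g' t) volume 0 1 :=
    (intervalIntegrable_delta hN hy0 hy1).mul_continuousOn hg'c
  rw [abs_sub_comm, ← hid, ← intervalIntegral.integral_const_mul]
  calc |∫ t in (0 : ℝ)..1, delta y t * g' t| ≤ ∫ t in (0 : ℝ)..1, |delta y t * g' t| :=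
        abs_integral_le_integral_abs zero_le_one
    _ ≤ ∫ t in (0 : ℝ)..1, boxDiscrepancy y * |g' t| := by
        refine integral_mono_on zero_le_one hΔint.abs (hg'c.abs.intervalIntegrable.const_mul _) fun t ht => ?_
        rw [abs_mul]
        exact mul_le_mul_of_nonneg_right (abs_delta_le_boxDiscrepancy hy0 ht) (abs_nonneg _)

end

end Discrepancy

end Literature.NumberTheory.DiophantineApproximation
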